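import Summits.BirchSwinnertonDyer.BirchSwinnertonDyer.Theorems.KimAtThreeDeepLowerOffStratumLevelLoweringRekey
import Literature.NumberTheory.EllipticCurves.StabilisedLevelLoweringCongruence
import Literature.NumberTheory.EllipticCurves.PAdicLFunctionDistributionHoldsProofs
import Literature.NumberTheory.EllipticCurves.ModularFormsGamma0Genus
import Literature.NumberTheory.EllipticCurves.PAdicLFunctionProofs
import Mathlib.NumberTheory.Padics.Complex
import HarnessLib

/-!
# Route `KimAtThreeKolyvagin` (rung W2), crux `DeepLowerAtThreeOffKatoStratum` (item 19679), registered
# stub `stub_nonAdditive`, ROAD (b) «Tamagawa level-lowering»: the displayed hypothesis (LL_1)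
# `IsStabilisedLevelLoweringCongruenceIn W 3 1 f q π` FROM A CANONICAL-PERIOD SYMBOL CONGRUENCE — core assembly

Cell `bsd-addord`, seat `bsd-addord-w2-acc2` (PROGRAMME PART 1b, ACCEL-LIST row (2)), gen 4; item
`stmt-BirchSwinnertonDyer-19679` (OWNER w2-c2 assembles; this file is `--supports`, closes nothing). Executes
plan g17/g18's ROAD (b) (pub/bsd-addord STATUS l.882 (2) / l.982): (LL_1) from Ribet + the canonical-period
congruence of plus symbols of congruent eigenforms (Vatsal 1999 / Greenberg–Vatsal 2000, typed by the
`bsd-litref` seat jsw17-ty as `vatsal1999_plusSymbol_congruence` / `greenbergVatsal2000_plusSymbol_congruence`)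
+ the `q`-stabilisation `g − β·g(q·)`. THIS FILE is the fact-free CORE (pure algebra over `ℚ̄₃`); the sequel
`KimAtThreeDeepLowerOffStratumLevelLoweringVatsalRows` plugs in the two named facts and derives the rows.

## What is proved (theorems only; no definition, no named fact, no `sorry`)

* §0 Bookkeeping for the reduction map `res : 𝒪 → 𝓀` of `𝒪 = 𝒪_{ℚ̄₃} = Valued.integer (PadicAlgCl 3)`
  onto its residue field `𝓀 = IsLocalRing.ResidueField 𝒪` (Mathlib objects; nothing defined here):
  `𝓀` has characteristic `3` (`charP_residueField`); congruent integral elements have equal residues; the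
  residue of a `3`-integral RATIONAL `r` is its class `r mod 3 ∈ 𝔽₃` read along
  `ZMod.castHom : 𝔽₃ → 𝓀` (`residue_mk_ratCast`) — the bridge between the route's `𝔽₃`-valued currency
  `ratModP 3 [x]⁺_f` and Vatsal's `𝔭`-adic currency.
* §1 `plusSymbol_eq_ratPlusSymbol_mul_plusPeriod`: for the newform `f` of an elliptic curve,
  `plusSymbol f x = [x]⁺_f · Ω⁺_f` (`[x]⁺_f = ratPlusSymbol f x ∈ ℚ`, `Ω⁺_f = plusPeriod f > 0`), from the
  DISCHARGED tree facts `ratCast_ratPlusSymbol_holds` (Manin–Drinfeld), `plusSymbol_eq_re_holds`,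
  `IsNewform0.plusPeriod_pos_holds`.
* §2 ★ `isStabilisedLevelLoweringCongruenceIn_of_symbolCongruence` — THEOREM A (core). INPUT (all
  displayed): (i) the CONCLUSION SHAPE of Vatsal 1999 §1 for the pair `(f, g')` at level `N` read through
  `ι : ℚ̄₃ ≃ ℂ` — periods `Ω_f, Ω_g ∈ ℂˣ` with `plusSymbol g' x/Ω_g` integral, `plusSymbol f x/Ω_f ≡
  plusSymbol g' x/Ω_g (mod 𝔪)` for all `x`, and `plusSymbol f x₁/Ω_f` a unit for some `x₁` (Vatsal (1.6),
  Remark (1.12)); (ii) the OLD SHAPE of `g'`: `plusSymbol g' x = Φ(x) − c·Φ(qx)` with `c ≡ 1 (mod 𝔪)`, `Φ`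
  `1`-periodic and Hecke at every prime `ℓ ∤ 3N_E` with eigenvalues `b_ℓ ≡ a_ℓ(E) (mod 𝔪)` — in print
  `Φ = plusSymbol g` for Ribet's level-`N/q` newform `g`, `g' = g − β g(q·)`, `c = β/q`, `β ≡ q`
  (`{∞, x}_{g(q·)} = q⁻¹{∞, qx}_g`); (iii) NON-DEGENERACY: some `Ω ∈ ℂ` makes `Φ/Ω` integral with
  `(Φ(x₀) − cΦ(qx₀))/Ω` a unit for some `x₀` — Ihara's lemma (Ribet 1984 Thm. 4.1) read on plus symbols:
  the `q`-old symbol of the optimally normalised `Φ` does not vanish mod `𝔭`; (iv) the row's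
  `3`-integrality of `[x]⁺_f` (`hint`, a binder of the registered stub). OUTPUT: `π : 𝔽₃ → 𝓀` and
  `IsStabilisedLevelLoweringCongruenceIn W 3 1 f q π` with `φ = (Φ/Ω mod 𝔪)`,
  `u = (Ω_f/Ω⁺_f)(Ω/Ω_g) mod 𝔪` (both period ratios are integral: evaluate at `x₁`, resp. `x₀`).

## Honest framing / what is NOT here

Nothing in print is asserted: the Vatsal / Greenberg–Vatsal facts enter only in the sequel, by name. The
three displayed inputs (ii)–(iii) are exactly what remains of ROAD (b) after the named facts: the
EXISTENCE of the level-`N/q` eigenform (Ribet 1990 Thm. 1.1 = tree fact `diamond1995_refinedSerre`, plus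
the `CuspForm`-currency construction of `g − β g(q·)` via the tree's `iota` / `qExpansion_coeff_iota` /
`modularSymbol_slash_tpD`) and the NON-VANISHING of its stabilised symbol mod `𝔭` (Ihara: tree fact
`ribet1984_iharaLemma` in period-homology currency, cell b2b-bsdres' `hasOldEigenPlusSymb_of_ribet1984_iharaLemma`
being the model of the missing dictionary). Relative to gen 2's road (`…LevelLoweringFromPrint`:
`wiles1995_multiplicityOne` + cell b2b-bsdres' Eichler–Shimura node with the `p = 3` rider «a prime
`≡ 2 (mod 3)` divides `N`» + the level-`N/q` eigen-datum node + Ihara) the MULTIPLICITY-ONE input is now a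
refereed named fact in symbol currency (Vatsal's Condition 2 ⟸ Thm. (1.13)), so the Eichler–Shimura node
and its rider disappear. BSD is not proved by any of this; nothing is booked; no mark moves.

PRESEARCH (2026-08-27, corpus fts+vec AND galaxy, re-reading the typer's records in
`CanonicalPeriodSymbolCongruence.lean` / `StabilisedLevelLoweringCongruence.lean`): no source prints (LL_1)
symbol-wise at a Tamagawa prime; Vatsal 1999 (1.6)/(11)/Rem. (1.12)/Thm. (1.13) and GV 2000 §3 (18)–(19)
print the congruence of canonically normalised symbols of two congruent level-`M` eigenforms (the typed
input); EPW 2006 Prop. 4.1.1, Kim 2022 §1.5.1 («expected»), Kim–Ota 2023 Prop. 8.1 are not symbol-wise.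

## References

* V. Vatsal, *Canonical periods and congruence formulae*, Duke Math. J. 98 (1999) 397–419, §1 (1.1)–(1.7),
  (11), Remark (1.12), Thm. (1.13). [Vatsal1999]
* R. Greenberg, V. Vatsal, *On the Iwasawa invariants of elliptic curves*, Invent. Math. 142 (2000), §3
  (17)–(19), Prop. (3.1), Rem. (3.4), Lemma (3.6), Thm. (3.10). [GreenbergVatsal2000]
* K. A. Ribet, Invent. Math. 100 (1990), Thm. 1.1 [Ribet1990]; Proc. ICM 1983 (1984), Thm. 4.1 [Ribet1984ICM].
* B. Mazur, J. Tate, J. Teitelbaum, Invent. Math. 84 (1986), §I.4 (4.2), §I.8. [MazurTateTeitelbaum1986Invent]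
* C.-H. Kim, *The structure of Selmer groups and the Iwasawa main conjecture for elliptic curves* (2022/2026),
  §1.5.1, Conj. 1.10. [Kim2022StructureSelmer]
-/

set_option autoImplicit false
-- the Theorems namespace of a single-conjunct summit repeats the summit name by design (D-0017)
set_option linter.dupNamespace false

noncomputable section

open scoped MatrixGroups ModularForm Classical NNReal

open CongruenceSubgroup WeierstrassCurve Literature.NumberTheory.EllipticCurves
  Literature.NumberTheory.EllipticCurves.ModularForms
open Literature.NumberTheory.DiophantineGeometry.Dioph (ratModP)
open Summit.BirchSwinnertonDyer.BirchSwinnertonDyer.Theorems.KimAtThreeDeepLowerTamagawaLevelLowering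
  (not_dvd_den_of_padicValRat_nonneg)

namespace Summit.BirchSwinnertonDyer.BirchSwinnertonDyer.Theorems.KimAtThreeDeepLowerOffStratumLevelLoweringVatsal

/-! ### §0 Reduction modulo the maximal ideal of `𝒪_{ℚ̄₃}` (no definitions: `𝒪 = Valued.integer ℚ̄₃`,
`𝓀 = IsLocalRing.ResidueField 𝒪`, `res = IsLocalRing.residue 𝒪` are Mathlib's) -/

section Residue

/-- `‖x‖ ≤ 1` iff `x ∈ 𝒪_{ℚ̄₃}`. [folklore] -/
theorem mem_integer_iff_norm_le_one {x : PadicAlgCl 3} :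
    x ∈ Valued.integer (PadicAlgCl 3) ↔ ‖x‖ ≤ 1 := by
  rw [Valuation.mem_integer_iff, PadicAlgCl.valuation_def, ← NNReal.coe_le_coe, coe_nnnorm, NNReal.coe_one]

/-- `Valued.v x ≤ 1 ↔ ‖x‖ ≤ 1` on `ℚ̄₃`. [folklore] -/
theorem valuation_le_one_iff {x : PadicAlgCl 3} : Valued.v x ≤ 1 ↔ ‖x‖ ≤ 1 := by
  rw [PadicAlgCl.valuation_def, ← NNReal.coe_le_coe, coe_nnnorm, NNReal.coe_one]

/-- `Valued.v x < 1 ↔ ‖x‖ < 1` on `ℚ̄₃`. [folklore] -/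
theorem valuation_lt_one_iff {x : PadicAlgCl 3} : Valued.v x < 1 ↔ ‖x‖ < 1 := by
  rw [PadicAlgCl.valuation_def, ← NNReal.coe_lt_coe, coe_nnnorm, NNReal.coe_one]

/-- `Valued.v x = 1 ↔ ‖x‖ = 1` on `ℚ̄₃`. [folklore] -/
theorem valuation_eq_one_iff {x : PadicAlgCl 3} : Valued.v x = 1 ↔ ‖x‖ = 1 := by
  rw [PadicAlgCl.valuation_def, ← NNReal.coe_inj, coe_nnnorm, NNReal.coe_one]

/-- An element of `𝒪` of norm `< 1` lies in the maximal ideal: its residue vanishes. [folklore] -/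
theorem residue_mk_eq_zero_of_norm_lt_one {x : PadicAlgCl 3} (hx : x ∈ Valued.integer (PadicAlgCl 3))
    (h : ‖x‖ < 1) : IsLocalRing.residue (Valued.integer (PadicAlgCl 3)) ⟨x, hx⟩ = 0 := by
  rw [IsLocalRing.residue_eq_zero_iff, IsLocalRing.mem_maximalIdeal, mem_nonunits_iff,
    Valuation.Integer.not_isUnit_iff_valuation_lt_one, PadicAlgCl.valuation_def]
  exact_mod_cast h

/-- Elements of `𝒪` congruent modulo `𝔪` have the same residue. [folklore] -/
theorem residue_mk_eq_of_norm_sub_lt_one {x y : PadicAlgCl 3} (hx : x ∈ Valued.integer (PadicAlgCl 3))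
    (hy : y ∈ Valued.integer (PadicAlgCl 3)) (h : ‖x - y‖ < 1) :
    IsLocalRing.residue (Valued.integer (PadicAlgCl 3)) ⟨x, hx⟩ =
      IsLocalRing.residue (Valued.integer (PadicAlgCl 3)) ⟨y, hy⟩ := by
  rw [← sub_eq_zero, ← map_sub]
  exact residue_mk_eq_zero_of_norm_lt_one (sub_mem hx hy) h

/-- Integers lie in `𝒪_{ℚ̄₃}`. [folklore] -/
theorem norm_intCast_le_one (z : ℤ) : ‖(z : PadicAlgCl 3)‖ ≤ 1 := by
  rw [show (z : PadicAlgCl 3) = ((z : ℚ_[3]) : PadicAlgCl 3) by rfl, PadicAlgCl.norm_extends]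
  exact Padic.norm_int_le_one z

/-- The residue of an integer is its image in `𝓀`. [folklore] -/
theorem residue_mk_intCast (z : ℤ) (hz : (z : PadicAlgCl 3) ∈ Valued.integer (PadicAlgCl 3)) :
    IsLocalRing.residue (Valued.integer (PadicAlgCl 3)) ⟨(z : PadicAlgCl 3), hz⟩ = (z : _) := by
  rw [← map_intCast (IsLocalRing.residue (Valued.integer (PadicAlgCl 3))) z]
  rfl

/-- **The residue field `𝓀 = 𝒪_{ℚ̄₃}/𝔪` has characteristic `3`.** [folklore] -/
theorem charP_residueField : CharP (IsLocalRing.ResidueField (Valued.integer (PadicAlgCl 3))) 3 := by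
  have h3 : ‖((3 : ℤ) : PadicAlgCl 3)‖ < 1 := by
    rw [show ((3 : ℤ) : PadicAlgCl 3) = (((3 : ℤ) : ℚ_[3]) : PadicAlgCl 3) by push_cast; rfl,
      PadicAlgCl.norm_extends]
    exact (Padic.norm_intCast_lt_one_iff (p := 3) (k := 3)).mpr (dvd_refl _)
  have h0 : ((3 : ℕ) : IsLocalRing.ResidueField (Valued.integer (PadicAlgCl 3))) = 0 := by
    have := residue_mk_eq_zero_of_norm_lt_one (mem_integer_iff_norm_le_one.mpr h3.le) h3
    rw [residue_mk_intCast] at this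
    exact_mod_cast this
  exact (CharP.charP_iff_prime_eq_zero Nat.prime_three).2 h0

/-- A rational with denominator prime to `3` lies in `𝒪_{ℚ̄₃}`. [folklore] -/
theorem norm_ratCast_le_one {r : ℚ} (hr : ¬ 3 ∣ r.den) : ‖(r : PadicAlgCl 3)‖ ≤ 1 := by
  rw [show (r : PadicAlgCl 3) = ((r : ℚ_[3]) : PadicAlgCl 3) by push_cast; rfl, PadicAlgCl.norm_extends]
  exact Padic.norm_rat_le_one hr

/-- **The residue of a `3`-integral rational `r` is the class `r mod 3 ∈ 𝔽₃`, read in `𝓀`.** [folklore] -/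
theorem residue_mk_ratCast {r : ℚ} (hr : ¬ 3 ∣ r.den) (h : (r : PadicAlgCl 3) ∈ Valued.integer (PadicAlgCl 3)) :
    IsLocalRing.residue (Valued.integer (PadicAlgCl 3)) ⟨(r : PadicAlgCl 3), h⟩ =
      (haveI := charP_residueField; ZMod.castHom (dvd_refl 3) _ (r : ZMod 3)) := by
  haveI := charP_residueField
  set res := IsLocalRing.residue (Valued.integer (PadicAlgCl 3)) with hres
  have hden : (r.den : ZMod 3) ≠ 0 := by rw [Ne, ZMod.natCast_eq_zero_iff]; exact hr
  have hden' : ((r.den : ℤ) : IsLocalRing.ResidueField (Valued.integer (PadicAlgCl 3))) ≠ 0 := by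
    intro h0
    rw [Int.cast_natCast] at h0
    exact hr ((CharP.cast_eq_zero_iff _ 3 r.den).mp h0)
  have hdenmem : ((r.den : ℤ) : PadicAlgCl 3) ∈ Valued.integer (PadicAlgCl 3) :=
    mem_integer_iff_norm_le_one.mpr (norm_intCast_le_one _)
  -- `r · den = num` in `𝒪`, reduce
  have hO : (⟨(r : PadicAlgCl 3), h⟩ : Valued.integer (PadicAlgCl 3)) * ⟨((r.den : ℤ) : PadicAlgCl 3), hdenmem⟩ =
      ((r.num : ℤ) : Valued.integer (PadicAlgCl 3)) := by
    apply Subtype.ext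
    show (r : PadicAlgCl 3) * ((r.den : ℤ) : PadicAlgCl 3) = ((r.num : ℤ) : PadicAlgCl 3)
    exact_mod_cast congrArg (fun x : ℚ => (x : PadicAlgCl 3)) (Rat.mul_den_eq_num r)
  have h2 : res ⟨(r : PadicAlgCl 3), h⟩ * ((r.den : ℤ) : _) = ((r.num : ℤ) : _) := by
    rw [← residue_mk_intCast (r.den : ℤ) hdenmem, ← map_mul, hO, map_intCast]
  set πc : ZMod 3 →+* IsLocalRing.ResidueField (Valued.integer (PadicAlgCl 3)) := ZMod.castHom (dvd_refl 3) _
    with hπc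
  have h3 : πc (r : ZMod 3) * ((r.den : ℤ) : _) = ((r.num : ℤ) : _) := by
    rw [← map_intCast πc (r.den : ℤ), ← map_mul, ← map_intCast πc r.num]
    congr 1
    rw [Int.cast_natCast, Rat.cast_def, div_mul_cancel₀ _ hden]
  exact mul_right_cancel₀ hden' (h2.trans h3.symm)

end Residue

/-! ### §1 The `f`-side bridge: the tree's rational plus symbol times the real period is the plus symbol -/

section FSide

variable {N : ℕ} [NeZero N]

/-- For the newform `f` of an elliptic curve (rational coefficients), `plusSymbol f x = [x]⁺_f · Ω⁺_f` with
`[x]⁺_f = ratPlusSymbol f x ∈ ℚ` and `Ω⁺_f = plusPeriod f > 0` (Manin–Drinfeld + `plusSymbol = re`):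
the tree's facts `ratCast_ratPlusSymbol_holds`, `plusSymbol_eq_re_holds`, `IsNewform0.plusPeriod_pos_holds`.
[cite: MazurTateTeitelbaum1986Invent, §I.8] -/
theorem plusSymbol_eq_ratPlusSymbol_mul_plusPeriod {W : WeierstrassCurve ℚ} {f : CuspForm (Gamma0 N) 2}
    (hf : IsNewformOf W f) (x : ℚ) :
    plusSymbol f x = ((ratPlusSymbol f x : ℚ) : ℂ) * ((plusPeriod f : ℝ) : ℂ) := by
  have hQ := hf.coeffField_eq_bot
  have hΩ : 0 < plusPeriod f := IsNewform0.plusPeriod_pos_holds hf.1 hQ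
  have hreal : ∀ n, (cuspCoeff f n).im = 0 := fun n => by rw [hf.2 n]; simp
  have h1 : (ratPlusSymbol f x : ℝ) = normalizedPlusSymbol f x := ratCast_ratPlusSymbol_holds hf.1 hQ x
  have h2 : plusSymbol f x = ((modularSymbol f x).re : ℂ) := plusSymbol_eq_re_holds f hreal x
  have h3 : plusSymbol f x = ((plusSymbol f x).re : ℂ) := by rw [h2, Complex.ofReal_re]
  rw [normalizedPlusSymbol, eq_div_iff hΩ.ne'] at h1
  rw [h3, ← h1]
  push_cast
  ring

end FSide

/-! ### §2 THEOREM A (core): the symbol congruence + old shape + non-degeneracy ⟹ (LL_1) over `𝓀` -/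

section Core

/-- **ROAD (b), core assembly.** Let `f` be the newform of `W` at level `N` with `3`-integral plus
symbols `[x]⁺_f` (`hint`), and `g' ∈ S₂(Γ₀(N))` any form; suppose (the CONCLUSION SHAPE of
Vatsal 1999 §1 / `vatsal1999_plusSymbol_congruence` for the pair `(f, g')`, read through
`ι : ℚ̄₃ ≃ ℂ`): there are `Ω_f, Ω_g ∈ ℂˣ` with `plusSymbol f x/Ω_f`, `plusSymbol g' x/Ω_g` integral and
congruent modulo `𝔪` for every `x`, and `plusSymbol f x₁/Ω_f` a unit for some `x₁`. Suppose the plus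
symbol of `g'` has the OLD SHAPE `plusSymbol g' x = Φ(x) − c·Φ(qx)` with `c ≡ 1 (mod 𝔪)`, `Φ`
`1`-periodic and Hecke at every prime `ℓ ∤ 3N_E` with eigenvalues `b_ℓ ≡ a_ℓ(E) (mod 𝔪)` (in print:
`Φ = plusSymbol g`, `g` Ribet's level-`N/q` eigenform, `g' = g − β·g(q·)`, `c = β/q`, `β ≡ q`), and the
NON-DEGENERACY: for some `Ω ∈ ℂ`, `Φ/Ω` is integral and `(Φ(x₀) − cΦ(qx₀))/Ω` is a unit for some `x₀`
(Ihara's lemma read on symbols). THEN the displayed hypothesis (LL_1) of route W2 holds in the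
residue field `𝓀 = 𝒪_{ℚ̄₃}/𝔪` along `π : 𝔽₃ → 𝓀`:
`IsStabilisedLevelLoweringCongruenceIn W 3 1 f q π`, with `φ = (Φ/Ω mod 𝔪)` and
`u = (Ω_f/Ω⁺_f)·(Ω/Ω_g) mod 𝔪`. Pure algebra + `plusSymbol_eq_ratPlusSymbol_mul_plusPeriod`.
[cite: Vatsal1999, §1 (1.6) display (11), Remark (1.12)] [cite: GreenbergVatsal2000, §3 (18)–(19)]
[cite: MazurTateTeitelbaum1986Invent, §I.4 (4.2) and §I.8] -/
theorem isStabilisedLevelLoweringCongruenceIn_of_symbolCongruence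
    (W : WeierstrassCurve ℚ) [W.IsElliptic] [W.IsGloballyMinimal] {N : ℕ} [NeZero N]
    {f g' : CuspForm (Gamma0 N) 2} (hf : IsNewformOf W f) (ι : PadicAlgCl 3 ≃+* ℂ)
    (hint : ∀ r : ℚ, ratPlusSymbol f r ≠ 0 → 0 ≤ padicValRat 3 (ratPlusSymbol f r))
    {Ωf Ωg : ℂ} (hΩf : Ωf ≠ 0) (hΩg : Ωg ≠ 0)
    (hψint : ∀ x : ℚ, Valued.v (ι.symm (plusSymbol g' x / Ωg)) ≤ 1)
    (hcongr : ∀ x : ℚ, Valued.v (ι.symm (plusSymbol f x / Ωf - plusSymbol g' x / Ωg)) < 1)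
    (hΨunit : ∃ x₁ : ℚ, Valued.v (ι.symm (plusSymbol f x₁ / Ωf)) = 1)
    (q : ℕ) (Φ : ℚ → ℂ) (c : ℂ) (b : ℕ → ℂ)
    (hshape : ∀ x : ℚ, plusSymbol g' x = Φ x - c * Φ (q * x))
    (hc : Valued.v (ι.symm (c - 1)) < 1)
    (hΦper : ∀ x : ℚ, Φ (x + 1) = Φ x)
    (hb : ∀ ℓ : ℕ, ℓ.Prime → ¬ ℓ ∣ W.conductorNorm ℤ * 3 →
      Valued.v (ι.symm (b ℓ - (W.frobeniusTrace ℓ : ℂ))) < 1)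
    (hΦhecke : ∀ ℓ : ℕ, ℓ.Prime → ¬ ℓ ∣ W.conductorNorm ℤ * 3 → ∀ x : ℚ,
      b ℓ * Φ x = (∑ j : Fin ℓ, Φ ((x + j) / ℓ)) + Φ (ℓ * x))
    {Ω : ℂ} (hΩint : ∀ x : ℚ, Valued.v (ι.symm (Φ x / Ω)) ≤ 1)
    (hΩunit : ∃ x₀ : ℚ, Valued.v (ι.symm ((Φ x₀ - c * Φ (q * x₀)) / Ω)) = 1) :
    ∃ π : ZMod 3 →+* IsLocalRing.ResidueField (Valued.integer (PadicAlgCl 3)),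
      IsStabilisedLevelLoweringCongruenceIn W 3 1 f q π := by
  classical
  haveI := charP_residueField
  set res := IsLocalRing.residue (Valued.integer (PadicAlgCl 3)) with hres
  -- Step 1 (`f`-side): `[x]⁺ = κ·Ψ(x)`, `Ψ(x) = plusSymbol f x/Ω_f`, `κ = Ω_f/Ω⁺`, `‖κ‖ ≤ 1`
  have hΩpos : 0 < plusPeriod f := IsNewform0.plusPeriod_pos_holds hf.1 hf.coeffField_eq_bot
  set κ : ℂ := Ωf / ((plusPeriod f : ℝ) : ℂ) with hκdef
  have hκ : ∀ x : ℚ, ((ratPlusSymbol f x : ℚ) : ℂ) = κ * (plusSymbol f x / Ωf) := by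
    intro x
    rw [plusSymbol_eq_ratPlusSymbol_mul_plusPeriod hf x, hκdef]
    have : ((plusPeriod f : ℝ) : ℂ) ≠ 0 := by exact_mod_cast hΩpos.ne'
    field_simp
  have hratint : ∀ x : ℚ, ‖ι.symm (((ratPlusSymbol f x : ℚ) : ℂ))‖ ≤ 1 := by
    intro x
    rw [map_ratCast]
    exact norm_ratCast_le_one (not_dvd_den_of_padicValRat_nonneg 3 f hint x)
  have hκint : ‖ι.symm κ‖ ≤ 1 := by
    obtain ⟨x₁, hx₁⟩ := hΨunit
    have h := congrArg ι.symm (hκ x₁)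
    rw [map_mul] at h
    have h' : ‖ι.symm (((ratPlusSymbol f x₁ : ℚ) : ℂ))‖ = ‖ι.symm κ‖ := by
      rw [h, norm_mul, valuation_eq_one_iff.mp hx₁, mul_one]
    rw [← h']
    exact hratint x₁
  -- Step 2 (`g`-side): `ψ(x) = λ · (Φ(x) − cΦ(qx))/Ω` with `λ = Ω/Ω_g`, `‖λ‖ ≤ 1`
  have hΩ0 : Ω ≠ 0 := by
    rintro rfl
    obtain ⟨x₀, h0⟩ := hΩunit
    exact zero_ne_one (by rwa [div_zero, map_zero, Valuation.map_zero] at h0)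
  set lam : ℂ := Ω / Ωg with hlamdef
  have hlam : ∀ x : ℚ, plusSymbol g' x / Ωg = lam * ((Φ x - c * Φ (q * x)) / Ω) := by
    intro x
    rw [hshape x, hlamdef]
    field_simp
  have hlamint : ‖ι.symm lam‖ ≤ 1 := by
    obtain ⟨x₀, hx₀⟩ := hΩunit
    have h := congrArg ι.symm (hlam x₀)
    rw [map_mul] at h
    have h' : ‖ι.symm (plusSymbol g' x₀ / Ωg)‖ = ‖ι.symm lam‖ := by
      rw [h, norm_mul, valuation_eq_one_iff.mp hx₀, mul_one]
    rw [← h']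
    exact valuation_le_one_iff.mp (hψint x₀)
  -- Step 3: `c` is integral with residue `1`
  have hcint : ‖ι.symm c‖ ≤ 1 := by
    have : ι.symm c = ι.symm (c - 1) + 1 := by rw [map_sub, map_one, sub_add_cancel]
    rw [this]
    exact (PadicAlgCl.isNonarchimedean 3 _ _).trans (max_le (valuation_lt_one_iff.mp hc).le (by rw [norm_one]))
  -- membership proofs in `𝒪`
  have mΦ : ∀ x : ℚ, ι.symm (Φ x / Ω) ∈ Valued.integer (PadicAlgCl 3) := fun x =>
    mem_integer_iff_norm_le_one.mpr (valuation_le_one_iff.mp (hΩint x))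
  have mκ : ι.symm κ ∈ Valued.integer (PadicAlgCl 3) := mem_integer_iff_norm_le_one.mpr hκint
  have mlam : ι.symm lam ∈ Valued.integer (PadicAlgCl 3) := mem_integer_iff_norm_le_one.mpr hlamint
  have mc : ι.symm c ∈ Valued.integer (PadicAlgCl 3) := mem_integer_iff_norm_le_one.mpr hcint
  have mΨ : ∀ x : ℚ, ι.symm (plusSymbol f x / Ωf) ∈ Valued.integer (PadicAlgCl 3) := by
    intro x
    have h1 := valuation_lt_one_iff.mp (hcongr x)
    have h2 := valuation_le_one_iff.mp (hψint x)
    rw [map_sub] at h1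
    refine mem_integer_iff_norm_le_one.mpr ?_
    have : ι.symm (plusSymbol f x / Ωf) =
        (ι.symm (plusSymbol f x / Ωf) - ι.symm (plusSymbol g' x / Ωg)) + ι.symm (plusSymbol g' x / Ωg) := by
      ring
    rw [this]
    exact (PadicAlgCl.isNonarchimedean 3 _ _).trans (max_le h1.le h2)
  have mψ : ∀ x : ℚ, ι.symm (plusSymbol g' x / Ωg) ∈ Valued.integer (PadicAlgCl 3) := fun x =>
    mem_integer_iff_norm_le_one.mpr (valuation_le_one_iff.mp (hψint x))
  have mrat : ∀ x : ℚ, ((ratPlusSymbol f x : ℚ) : PadicAlgCl 3) ∈ Valued.integer (PadicAlgCl 3) := fun x =>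
    mem_integer_iff_norm_le_one.mpr (norm_ratCast_le_one (not_dvd_den_of_padicValRat_nonneg 3 f hint x))
  -- the data
  let π : ZMod 3 →+* IsLocalRing.ResidueField (Valued.integer (PadicAlgCl 3)) := ZMod.castHom (dvd_refl 3) _
  let φ : ℚ → IsLocalRing.ResidueField (Valued.integer (PadicAlgCl 3)) := fun x => res ⟨ι.symm (Φ x / Ω), mΦ x⟩
  let u : IsLocalRing.ResidueField (Valued.integer (PadicAlgCl 3)) := res ⟨ι.symm κ, mκ⟩ * res ⟨ι.symm lam, mlam⟩
  have hc1 : res ⟨ι.symm c, mc⟩ = 1 := by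
    have h := residue_mk_eq_of_norm_sub_lt_one mc (one_mem _) (by
      have : ι.symm c - 1 = ι.symm (c - 1) := by rw [map_sub, map_one]
      rw [this]; exact valuation_lt_one_iff.mp hc)
    rw [h]
    exact map_one res
  refine ⟨π, u, φ, fun x => ?_, fun ℓ hℓ hℓN x => ?_, fun x => ?_⟩
  · -- periodicity
    show res ⟨ι.symm (Φ (x + 1) / Ω), mΦ (x + 1)⟩ = res ⟨ι.symm (Φ x / Ω), mΦ x⟩
    congr 2
    rw [hΦper]
  · -- Hecke relation at a good prime `ℓ ∤ 3N_E`
    have hbint : ‖ι.symm (b ℓ)‖ ≤ 1 := by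
      have : ι.symm (b ℓ) = ι.symm (b ℓ - (W.frobeniusTrace ℓ : ℂ)) + ((W.frobeniusTrace ℓ : ℤ) : PadicAlgCl 3) := by
        rw [map_sub, map_intCast, sub_add_cancel]
      rw [this]
      exact (PadicAlgCl.isNonarchimedean 3 _ _).trans
        (max_le (valuation_lt_one_iff.mp (hb ℓ hℓ hℓN)).le (norm_intCast_le_one _))
    have mb : ι.symm (b ℓ) ∈ Valued.integer (PadicAlgCl 3) := mem_integer_iff_norm_le_one.mpr hbint
    have ma : ((W.frobeniusTrace ℓ : ℤ) : PadicAlgCl 3) ∈ Valued.integer (PadicAlgCl 3) :=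
      mem_integer_iff_norm_le_one.mpr (norm_intCast_le_one _)
    have hbres : res ⟨ι.symm (b ℓ), mb⟩ = (W.frobeniusTrace ℓ : _) := by
      rw [← residue_mk_intCast (W.frobeniusTrace ℓ) ma]
      refine residue_mk_eq_of_norm_sub_lt_one mb ma ?_
      have : ι.symm (b ℓ) - ((W.frobeniusTrace ℓ : ℤ) : PadicAlgCl 3) = ι.symm (b ℓ - (W.frobeniusTrace ℓ : ℂ)) := by
        rw [map_sub, map_intCast]
      rw [this]
      exact valuation_lt_one_iff.mp (hb ℓ hℓ hℓN)
    have hO : (⟨ι.symm (b ℓ), mb⟩ : Valued.integer (PadicAlgCl 3)) * ⟨ι.symm (Φ x / Ω), mΦ x⟩ =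
        (∑ j : Fin ℓ, ⟨ι.symm (Φ ((x + j) / ℓ) / Ω), mΦ ((x + j) / ℓ)⟩) + ⟨ι.symm (Φ (ℓ * x) / Ω), mΦ (ℓ * x)⟩ := by
      apply Subtype.ext
      push_cast
      rw [← map_mul, ← map_sum, ← map_add]
      congr 1
      have h := hΦhecke ℓ hℓ hℓN x
      rw [mul_div_assoc', h, add_div, Finset.sum_div]
    have h := congrArg res hO
    rw [map_mul, map_add, map_sum, hbres] at h
    exact h
  · -- the congruence `[x]⁺ ≡ u (φ(x) − φ(qx))`
    rw [KimAtThreeDeepLowerOffStratumLevelLoweringRekey.ratModP_three_pow_one_eq_ratCast]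
    show π ((ratPlusSymbol f x : ℚ) : ZMod 3) = u * (φ x - φ (q * x))
    have h1 : π ((ratPlusSymbol f x : ℚ) : ZMod 3) = res ⟨((ratPlusSymbol f x : ℚ) : PadicAlgCl 3), mrat x⟩ :=
      (residue_mk_ratCast (not_dvd_den_of_padicValRat_nonneg 3 f hint x) (mrat x)).symm
    have h2 : (⟨((ratPlusSymbol f x : ℚ) : PadicAlgCl 3), mrat x⟩ : Valued.integer (PadicAlgCl 3)) =
        ⟨ι.symm κ, mκ⟩ * ⟨ι.symm (plusSymbol f x / Ωf), mΨ x⟩ := by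
      apply Subtype.ext
      push_cast
      rw [← map_mul, ← hκ x, map_ratCast]
    have h3 : res ⟨ι.symm (plusSymbol f x / Ωf), mΨ x⟩ = res ⟨ι.symm (plusSymbol g' x / Ωg), mψ x⟩ := by
      refine residue_mk_eq_of_norm_sub_lt_one (mΨ x) (mψ x) ?_
      rw [← map_sub]
      exact valuation_lt_one_iff.mp (hcongr x)
    have h4 : (⟨ι.symm (plusSymbol g' x / Ωg), mψ x⟩ : Valued.integer (PadicAlgCl 3)) =
        ⟨ι.symm lam, mlam⟩ * (⟨ι.symm (Φ x / Ω), mΦ x⟩ - ⟨ι.symm c, mc⟩ * ⟨ι.symm (Φ (q * x) / Ω), mΦ (q * x)⟩) := by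
      apply Subtype.ext
      push_cast
      rw [← map_mul, ← map_sub, ← map_mul, hlam x]
      congr 1
      rw [sub_div, mul_div_assoc]
    rw [h1, h2, map_mul, h3, h4, map_mul, map_sub, map_mul, hc1, one_mul]
    show _ = res ⟨ι.symm κ, mκ⟩ * res ⟨ι.symm lam, mlam⟩ * (φ x - φ (q * x))
    ring

end Core

end Summit.BirchSwinnertonDyer.BirchSwinnertonDyer.Theorems.KimAtThreeDeepLowerOffStratumLevelLoweringVatsal

end
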